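import Mathlib
import HarnessLib
import Summits.HubbardSuperconductivity.HubbardSuperconductivity.Theorems.KLProgrammeKLRegimeEngineTowerRemeasureWt
import Summits.HubbardSuperconductivity.HubbardSuperconductivity.Theorems.KLProgrammeKLRegimeSectorMultiplierOverlapWt

/-!
# Route `KLProgramme` — crux K3 ENGINE (stmt-HubbardSuperconductivity-20437 `KLRegimeEngineV17F2`), stub (b) conjunct `KernelNormsWt4` and the weighted tower's
# imports: THE WEIGHTED ANISOTROPIC ALL-FIXED LINE FROM THE WEIGHTED PLAIN LINE, and THE WEIGHTED ONE-ANCHOR IMPORT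
# (cell gate-hubbard-kl, seat hubbard-kl-k3c2-p3 g15, row «sector-counting import», located «(ℓ)-IMPORT-WT»)

WHY.  Stub (b) concludes, next to `KernelNormsLevels … j` (unweighted, levelled), the first-moment-WEIGHTED one-anchor profile
`KernelNormsWt4 … j = ∀ m ≠ 2, ∀ q w, klWtPinnedSum … j m q w ≤ klWtBudget … j m` (weight `klScaleWt L M β j = 1 + Λ_j·diam`), and the weighted tower reads per block
the weighted input sizes `klTowerMeasWtAt … d k j m = sup klWtPinnedSumAt … (dk−1) j m (𝒱_{dk}) q w`.  Their two- and four-leg rows are IMPORTS.  This file is the weighted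
twin of `…EngineAnisoLineFromPlain` (p586153) / `…TowerImportXFloorPlain` (p690921): a weighted one-anchor size is (one-anchor sector count) × (WEIGHTED all-fixed
anisotropic line), and the weighted all-fixed anisotropic line is `(CAʷ)^{m+1}` × (WEIGHTED PLAIN line) — BGM (2.76)–(2.77) with the tree weight carried through the
transfer `E(F_J)·S(1)` by `IsTreeWeight` (`Literature.…PlateauPrescribedTreeWt.hubbardSectorPrescribedSumWt_refine_le_split_of_plateau_pair_treeWt` run on the plateau
pair (trivial, trivial ; `F_J`) with ONE parent — the pattern of `hubbardSectorPrescribedSumWt_klAniso_jump_le_split`, k3c2-p3 g6):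

* §1 **`transferSumsWt_klAniso_single_le`** — pair-weighted (weight `klScaleWt … j`) column and row sums of `E(klAnisoFamily J)·S(trivialMultiplier)` `≤ T/(βL²)` from a
  weighted single-multiplier character-sum bound `T` at the weight's scale (`overlapKernelWt_sums_le_of_charSumWt_le` with the trivial family);
* §2 **`wprescribedSum_klAniso_le_of_plain_treeWt`** — for ANY tree weight `wt`, position map `g`, Grassmann `G`, leg count `m+1`, fine label string `σ″` and pinned
  leg `p`: if the pair-weighted transfer sums are `≤ c₁ / c₁r` and every `wt`-weighted PLAIN pinned sum at leg `p` is `≤ N₁`, then the `wt`-weighted all-fixed `F_J`-pinned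
  sum at leg `p` is `≤ c₁^m·c₁r·ε^{m+1}·N₁`;
* §3 **`klWtPinnedSumAt_le_count_mul_wline`** — for a momentum-conserving `T`: `klWtPinnedSumAt … J j (m+1) T q (y, ℓ) ≤ N_c · Bʷ` whenever the one-anchor count of
  `bgmSectorSet (F_J) (m+1)` at leg `q` is `≤ N_c` and every compatible label string's `klScaleWt j`-weighted all-fixed pinned sum at leg `q` is `≤ Bʷ`;
* §4 **`klWtPinnedSumAt_le_count_mul_of_wplain`** — §1 ∘ §2 ∘ §3: count × `(T/(βL²))^{m}·(T/(βL²))·ε^{m+1}` × (weighted plain line).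
Everything is proved; no definitions; nothing about the model is asserted; nothing asserts (ℓ), any stub, K3 or superconductivity.
References: BGM 2006 §2.7 (2.70)–(2.71a), §2.8 (2.76)–(2.77), (2.82)–(2.84) [cite: BenfattoGiulianiMastropietro2006].
-/

noncomputable section

namespace Summit.HubbardSuperconductivity.HubbardSuperconductivity.Theorems.EngineV8

set_option linter.dupNamespace false -- summit = problem name (single-conjunct summit), D-0017

open Classical
open Real Finset Literature.MathematicalPhysics.QuantumLattice Literature.Probability.LatticeModels GrassmannAlgebra
open Literature.Probability.LatticeModels.BattleFederbush
open Summit.HubbardSuperconductivity.HubbardSuperconductivity.Theorems.KLProgrammeLegKernels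
open Summit.HubbardSuperconductivity.HubbardSuperconductivity.Theorems.KLRegimeSplit
open Summit.HubbardSuperconductivity.HubbardSuperconductivity.Theorems.TorusFourierL2
open Summit.HubbardSuperconductivity.HubbardSuperconductivity.Theorems.DispersionFlow
open Summit.HubbardSuperconductivity.HubbardSuperconductivity.Theorems.KLRegimeWick
open Literature.MathematicalPhysics.QuantumLattice.FermiRG

variable {L M : ℕ} [NeZero L] [NeZero M] {Λ : Type*} [DecidableEq Λ] {wt : Finset Λ → ℝ}

/-! ## §1 The weighted transfer sums of `E(F_J)·S(1)` from the weighted single character sum -/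

omit [DecidableEq Λ] in
/-- **WEIGHTED TRANSFER SUMS OF THE ANISOTROPIC FAMILY AGAINST THE TRIVIAL FAMILY**: if every single multiplier `F_{J,ω}` has `klScaleWt … j`-type weighted space-time
character sum `≤ T` (weight `1 + Λ_j·β/(2M)·|z₀| + Λ_j|z₁| + Λ_j|z₂|`), then the pair-weighted column AND row sums of `E(klAnisoFamily … J)·S(trivialMultiplier)` (labels
matched) are `≤ T/(βL²)`. [cite: BenfattoGiulianiMastropietro2006, §2.7 (2.70)-(2.71a)] -/
theorem transferSumsWt_klAniso_single_le {β : ℝ} (hβ : 0 < β) (μ : ℝ) (K : TrigPolyC4v) (J j : ℕ) {T : ℝ}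
    (hT : ∀ ω : Fin (sectorCount J), ∑ z : TorusSite 1 (2 * M) × TorusSite 2 L,
      (1 + klScale klE0 j * β / (2 * M) * |(((z.1 0).valMinAbs : ℤ) : ℝ)| + klScale klE0 j * |(((z.2 0).valMinAbs : ℤ) : ℝ)| +
          klScale klE0 j * |(((z.2 1).valMinAbs : ℤ) : ℝ)|) *
      ‖∑ q : TorusSite 1 (2 * M) × TorusSite 2 L, (torusChar q.1 z.1 * torusChar q.2 z.2) •
        klAnisoFamily L M β μ K klE0 J ω (⟨(q.1 0).val, ZMod.val_lt (q.1 0)⟩, q.2)‖ ≤ T) :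
    (∀ (ω' : Fin (sectorCount J)) (σ c : Fin 2) (y : SpaceTimeIdx L M),
      ∑ x : SpaceTimeIdx L M, ‖(sectorAnalysisMatrix L M β (klAnisoFamily L M β μ K klE0 J) * sectorSubMatrix L M β (trivialMultiplier L M))
          (y, ((ω', σ), c)) (x, (((0 : Fin 1), σ), c))‖ *
        klScaleWt L M β j {latticeLegPos (2 * (2 * M)) ((y, ((ω', σ), c)) : SpaceTimeIdx L M × SectorLeg (sectorCount J)),
          latticeLegPos (2 * (2 * M)) ((x, (((0 : Fin 1), σ), c)) : SpaceTimeIdx L M × SectorLeg 1)} ≤ T / (β * (L : ℝ) ^ 2)) ∧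
    (∀ (ω' : Fin (sectorCount J)) (σ c : Fin 2) (x : SpaceTimeIdx L M),
      ∑ y : SpaceTimeIdx L M, ‖(sectorAnalysisMatrix L M β (klAnisoFamily L M β μ K klE0 J) * sectorSubMatrix L M β (trivialMultiplier L M))
          (y, ((ω', σ), c)) (x, (((0 : Fin 1), σ), c))‖ *
        klScaleWt L M β j {latticeLegPos (2 * (2 * M)) ((y, ((ω', σ), c)) : SpaceTimeIdx L M × SectorLeg (sectorCount J)),
          latticeLegPos (2 * (2 * M)) ((x, (((0 : Fin 1), σ), c)) : SpaceTimeIdx L M × SectorLeg 1)} ≤ T / (β * (L : ℝ) ^ 2)) := by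
  have hT' : ∀ (ω' : Fin (sectorCount J)) (ω : Fin 1), ∑ z : TorusSite 1 (2 * M) × TorusSite 2 L,
      (1 + klScale klE0 j * β / (2 * M) * |(((z.1 0).valMinAbs : ℤ) : ℝ)| + klScale klE0 j * |(((z.2 0).valMinAbs : ℤ) : ℝ)| +
          klScale klE0 j * |(((z.2 1).valMinAbs : ℤ) : ℝ)|) *
      ‖∑ q : TorusSite 1 (2 * M) × TorusSite 2 L, (torusChar q.1 z.1 * torusChar q.2 z.2) •
        (klAnisoFamily L M β μ K klE0 J ω' (⟨(q.1 0).val, ZMod.val_lt (q.1 0)⟩, q.2) *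
          trivialMultiplier L M ω (⟨(q.1 0).val, ZMod.val_lt (q.1 0)⟩, q.2))‖ ≤ T := by
    intro ω' ω
    simp only [trivialMultiplier, mul_one]
    exact hT ω'
  have h := overlapKernelWt_sums_le_of_charSumWt_le hβ (klAnisoFamily L M β μ K klE0 J) (trivialMultiplier L M) j hT'
  exact ⟨fun ω' σ c y => h.1 ω' 0 σ c y, fun ω' σ c x => h.2 ω' 0 σ c x⟩

/-! ## §2 The weighted all-fixed anisotropic line from the weighted plain line (any tree weight, any leg count) -/

/-- **WEIGHTED ANISO ALL-FIXED PINNED SUMS ≤ `c₁^m·c₁r·ε^{m+1}` × WEIGHTED PLAIN PINNED SUMS** (any tree weight `wt`, position map `g`, Grassmann element `G`, family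
scale `J`, leg count `m + 1`, fine label string `σ″`, pinned leg `p`): with pair-weighted column sums `≤ c₁` and row sums `≤ c₁r` of `E(F_J)·S(1)` (labels matched)
and every `wt`-weighted PLAIN pinned sum at leg `p` (any spin/charge string `τ′`, any pin) `≤ N₁`,
`ε^m Σ_{x″_p = x} wt(g(x″))·‖W^{F_J}_{σ″}(G)(x″)‖ ≤ c₁^m·c₁r·ε^{m+1}·N₁`.  The tree-weighted refinement lemma on the plateau pair (trivial, trivial ; `F_J`), one parent.
[cite: BenfattoGiulianiMastropietro2006, §2.8 (2.76)-(2.77), (2.82)-(2.84)] -/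
theorem wprescribedSum_klAniso_le_of_plain_treeWt (hwt : IsTreeWeight wt) (g : SpaceTimeIdx L M → Λ) {β : ℝ} (hβ : 0 < β) (μ : ℝ) (K : TrigPolyC4v)
    (J : ℕ) (G : HubbardGrassmann L M) {c₁ c₁r N₁ : ℝ} (hc₁0 : 0 ≤ c₁) (hc₁r0 : 0 ≤ c₁r) (hN₁0 : 0 ≤ N₁)
    (hcol₁ : ∀ (ω'' : Fin (sectorCount J)) (σ c : Fin 2) (x' : SpaceTimeIdx L M),
      ∑ x'' : SpaceTimeIdx L M, ‖(sectorAnalysisMatrix L M β (klAnisoFamily L M β μ K klE0 J) * sectorSubMatrix L M β (trivialMultiplier L M))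
        (x'', ((ω'', σ), c)) (x', (((0 : Fin 1), σ), c))‖ * wt {g x'', g x'} ≤ c₁)
    (hrow₁ : ∀ (ω'' : Fin (sectorCount J)) (σ c : Fin 2) (x'' : SpaceTimeIdx L M),
      ∑ x' : SpaceTimeIdx L M, ‖(sectorAnalysisMatrix L M β (klAnisoFamily L M β μ K klE0 J) * sectorSubMatrix L M β (trivialMultiplier L M))
        (x'', ((ω'', σ), c)) (x', (((0 : Fin 1), σ), c))‖ * wt {g x'', g x'} ≤ c₁r)
    (m : ℕ) (σ'' : Fin (m + 1) → SectorLeg (sectorCount J)) (p : Fin (m + 1))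
    (hN₁ : ∀ (τ' : Fin (m + 1) → SectorLeg 1) (y : SpaceTimeIdx L M),
      imagTimeWeight β M ^ m * ∑ x' ∈ univ.filter (fun x' : Fin (m + 1) → SpaceTimeIdx L M => x' p = y),
        wt ((univ.image x').image g) * ‖sectorisedKernel L M β (trivialMultiplier L M) G (m + 1) τ' x'‖ ≤ N₁)
    (x : SpaceTimeIdx L M) :
    imagTimeWeight β M ^ m * ∑ x'' ∈ univ.filter (fun x'' : Fin (m + 1) → SpaceTimeIdx L M => x'' p = x),
        wt ((univ.image x'').image g) * ‖sectorisedKernel L M β (klAnisoFamily L M β μ K klE0 J) G (m + 1) σ'' x''‖ ≤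
      c₁ ^ m * c₁r * imagTimeWeight β M ^ (m + 1) * N₁ := by
  set F' := klAnisoFamily L M β μ K klE0 J with hF'
  set F₁ := trivialMultiplier L M with hF₁
  -- the per-pair position sums for arbitrary label pairs: mismatched spin/charge entries vanish, the coarse label is `0`
  have hcol₁' : ∀ (ℓ'' : SectorLeg (sectorCount J)) (X' : SpaceTimeIdx L M × SectorLeg 1),
      ∑ x'' : SpaceTimeIdx L M, ‖(sectorAnalysisMatrix L M β F' * sectorSubMatrix L M β F₁) (x'', ℓ'') X'‖ * wt {g x'', g X'.1} ≤ c₁ := by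
    rintro ⟨⟨ω'', σ''⟩, c''⟩ ⟨x', ⟨ω', σ'⟩, c'⟩
    obtain rfl : ω' = 0 := Subsingleton.elim _ _
    by_cases hlab : σ' = σ'' ∧ c' = c''
    · obtain ⟨rfl, rfl⟩ := hlab
      exact hcol₁ ω'' σ' c' x'
    · refine le_of_eq_of_le (sum_eq_zero fun x'' _ => ?_) hc₁0
      rw [sectorAnalysis_mul_sectorSub_apply, if_neg (by exact hlab), norm_zero, zero_mul]
  have hrow₁' : ∀ (X'' : SpaceTimeIdx L M × SectorLeg (sectorCount J)) (ℓ' : SectorLeg 1),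
      ∑ x' : SpaceTimeIdx L M, ‖(sectorAnalysisMatrix L M β F' * sectorSubMatrix L M β F₁) X'' (x', ℓ')‖ * wt {g X''.1, g x'} ≤ c₁r := by
    rintro ⟨x'', ⟨ω'', σ''⟩, c''⟩ ⟨⟨ω', σ'⟩, c'⟩
    obtain rfl : ω' = 0 := Subsingleton.elim _ _
    by_cases hlab : σ' = σ'' ∧ c' = c''
    · obtain ⟨rfl, rfl⟩ := hlab
      exact hrow₁ ω'' σ' c' x''
    · refine le_of_eq_of_le (sum_eq_zero fun x' _ => ?_) hc₁r0
      rw [sectorAnalysis_mul_sectorSub_apply, if_neg (by exact hlab), norm_zero, zero_mul]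
  -- the spin/charge-matched coarse legs: exactly one
  have hρ : ∀ ℓ'' : SectorLeg (sectorCount J),
      (((univ.filter fun ℓ' : SectorLeg 1 => True ∧ ℓ'.1.2 = ℓ''.1.2 ∧ ℓ'.2 = ℓ''.2).card : ℝ)) ≤ 1 := by
    intro ℓ''
    have hsub : (univ.filter fun ℓ' : SectorLeg 1 => True ∧ ℓ'.1.2 = ℓ''.1.2 ∧ ℓ'.2 = ℓ''.2) ⊆
        {((((0 : Fin 1), ℓ''.1.2), ℓ''.2) : SectorLeg 1)} := by
      rintro ⟨⟨ω', σ'⟩, c'⟩ h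
      rw [mem_filter] at h
      obtain rfl : ω' = 0 := Subsingleton.elim _ _
      rw [mem_singleton]
      obtain ⟨-, -, h2, h3⟩ := h
      simp only at h2 h3
      rw [h2, h3]
    have hcard := card_le_card hsub
    rw [card_singleton] at hcard
    exact_mod_cast hcard
  -- the weighted coarse prescribed sums (all legs prescribed: the single string `τ′`)
  have hfiltE : ∀ {Ns : ℕ} (τ' : Fin (m + 1) → SectorLeg Ns) (A : Finset (Fin (m + 1) → SectorLeg Ns)), τ' ∈ A →
      A.filter (fun σ' : Fin (m + 1) → SectorLeg Ns => ∀ e ∈ (univ : Finset (Fin (m + 1))), σ' e = τ' e) = {τ'} := by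
    intro Ns τ' A hA
    ext σ'
    simp only [mem_filter, mem_univ, true_implies, mem_singleton]
    constructor
    · rintro ⟨-, h⟩; exact funext h
    · rintro rfl; exact ⟨hA, fun _ => rfl⟩
  have hN₁' : ∀ (τ' : Fin (m + 1) → SectorLeg 1) (y : SpaceTimeIdx L M),
      imagTimeWeight β M ^ m *
        ∑ σ' ∈ univ.filter (fun σ' : Fin (m + 1) → SectorLeg 1 => ∀ e ∈ (univ : Finset (Fin (m + 1))), σ' e = τ' e),
          ∑ x' ∈ univ.filter (fun x' : Fin (m + 1) → SpaceTimeIdx L M => x' p = y),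
            wt ((univ.image x').image g) * ‖sectorisedKernel L M β F₁ G (m + 1) σ' x'‖ ≤ N₁ := by
    intro τ' y
    rw [hfiltE τ' univ (mem_univ _), sum_singleton]
    exact hN₁ τ' y
  have hN₂' : ∀ (τ' : Fin (m + 1) → SectorLeg 1) (y : SpaceTimeIdx L M),
      imagTimeWeight β M ^ m *
        ∑ σ' ∈ (∅ : Finset (Fin (m + 1) → SectorLeg 1)).filter
            (fun σ' : Fin (m + 1) → SectorLeg 1 => ∀ e ∈ (univ : Finset (Fin (m + 1))), σ' e = τ' e),
          ∑ x' ∈ univ.filter (fun x' : Fin (m + 1) → SpaceTimeIdx L M => x' p = y),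
            wt ((univ.image x').image g) * ‖sectorisedKernel L M β F₁ G (m + 1) σ' x'‖ ≤ 0 := by
    intro τ' y
    simp
  have h := hubbardSectorPrescribedSumWt_refine_le_split_of_plateau_pair_treeWt hwt g hβ F₁ F₁
    (fun ω q => by simp [hF₁, trivialMultiplier])
    (fun q hq ω => absurd hq (by simp [hF₁, trivialMultiplier])) F'
    (fun ω' q _ => by simp [hF₁, trivialMultiplier]) G
    (fun (_ : Fin (sectorCount J)) (_ : Fin 1) => True)
    (fun ω'' ω' hno q => absurd trivial hno)
    hc₁0 hc₁r0 zero_le_one le_rfl hN₁0 le_rfl hcol₁' hrow₁' hρ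
    m {σ''} ∅ univ σ'' p (mem_univ p)
    (fun σ' _ => by
      refine le_trans ?_ (le_of_eq Nat.cast_one)
      exact_mod_cast (card_filter_le _ _).trans (card_singleton σ'').le)
    (fun σ' hσ' => absurd hσ' (Finset.notMem_empty _)) hN₁' hN₂' x
  rw [hfiltE σ'' {σ''} (mem_singleton_self σ''), sum_singleton] at h
  refine h.trans (le_of_eq ?_)
  ring

/-! ## §3 The weighted one-anchor import: count × weighted all-fixed line -/

omit [NeZero M] [DecidableEq Λ] in
/-- **WEIGHTED ONE-ANCHOR SIZE ≤ ONE-ANCHOR COUNT × WEIGHTED ALL-FIXED LINE** (any momentum-conserving `T`, family `F_J`, rate `j`, leg count `m + 1`, pinned leg `q`,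
pin `(y, ℓ)`): if the one-anchor count `#{σ ∈ bgmSectorSet (F_J) (m+1) : σ q = ℓ}` is `≤ N_c` and every compatible label string `σ` has
`ε^m Σ_{x″_q = y} klScaleWt_j(pos x″)·‖W^{F_J}_σ(T)(x″)‖ ≤ Bʷ`, then `klWtPinnedSumAt L M β μ K J j (m+1) T q (y, ℓ) ≤ N_c·Bʷ`.
[cite: BenfattoGiulianiMastropietro2006, §2.8 (2.76)-(2.77)] -/
theorem klWtPinnedSumAt_le_count_mul_wline {β : ℝ} (hβ : 0 < β) (μ : ℝ) (K : TrigPolyC4v) (J j m : ℕ) (T : HubbardGrassmann L M)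
    (hT : ∀ (m' : ℕ) (X : Fin m' → HubbardFieldIdx L M), ∑ i, signedMomentum L (X i).2 (X i).1.1.2 ≠ 0 → kernel ℂ T m' X = 0)
    (q : Fin (m + 1)) (y : SpaceTimeIdx L M) (ℓ : SectorLeg (sectorCount J)) {Nc Bw : ℝ} (hBw : 0 ≤ Bw)
    (hcount : ((((bgmSectorSet L M (klAnisoFamily L M β μ K klE0 J) (m + 1)).filter
        (fun σ : Fin (m + 1) → SectorLeg (sectorCount J) => σ q = ℓ)).card : ℕ) : ℝ) ≤ Nc)
    (hline : ∀ σ ∈ bgmSectorSet L M (klAnisoFamily L M β μ K klE0 J) (m + 1),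
      imagTimeWeight β M ^ m * ∑ x'' ∈ univ.filter (fun x'' : Fin (m + 1) → SpaceTimeIdx L M => x'' q = y),
        klScaleWt L M β j ((univ.image x'').image (fun x : SpaceTimeIdx L M => (((((2 * (x.1 : ℕ) : ℕ)) : ZMod (2 * (2 * M)))), x.2))) *
          ‖sectorisedKernel L M β (klAnisoFamily L M β μ K klE0 J) T (m + 1) σ x''‖ ≤ Bw) :
    klWtPinnedSumAt L M β μ K J j (m + 1) T q (y, ℓ) ≤ Nc * Bw := by
  set F' := klAnisoFamily L M β μ K klE0 J with hF'
  set gpos : SpaceTimeIdx L M → ZMod (2 * (2 * M)) × TorusSite 2 L :=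
    fun x => (((((2 * (x.1 : ℕ) : ℕ)) : ZMod (2 * (2 * M)))), x.2) with hgpos
  have hε0 : 0 ≤ imagTimeWeight β M := imagTimeWeight_nonneg hβ.le M
  -- the carrier as a label-then-position double sum, restricted to `bgmSectorSet`
  rw [klWtPinnedSumAt_succ_eq_sum_sector]
  have hsub : (bgmSectorSet L M F' (m + 1)).filter (fun σ : Fin (m + 1) → SectorLeg (sectorCount J) => σ q = ℓ) ⊆
      univ.filter (fun σ : Fin (m + 1) → SectorLeg (sectorCount J) => σ q = ℓ) := filter_subset_filter _ (subset_univ _)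
  rw [← Finset.sum_subset hsub (fun σ hσuniv hσnot => ?_)]
  · rw [mul_sum]
    calc ∑ σ ∈ (bgmSectorSet L M F' (m + 1)).filter (fun σ => σ q = ℓ),
          imagTimeWeight β M ^ m * ∑ x'' ∈ univ.filter (fun x'' : Fin (m + 1) → SpaceTimeIdx L M => x'' q = y),
            klScaleWt L M β j ((univ.image x'').image gpos) * ‖sectorisedKernel L M β F' T (m + 1) σ x''‖
        ≤ ∑ _σ ∈ (bgmSectorSet L M F' (m + 1)).filter (fun σ => σ q = ℓ), Bw :=
          sum_le_sum fun σ hσ => hline σ (mem_filter.1 hσ).1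
      _ = (((bgmSectorSet L M F' (m + 1)).filter (fun σ => σ q = ℓ)).card : ℝ) * Bw := by rw [sum_const, nsmul_eq_mul]
      _ ≤ Nc * Bw := mul_le_mul_of_nonneg_right hcount hBw
  · have hP := (mem_filter.1 hσuniv).2
    have hnot : σ ∉ bgmSectorSet L M F' (m + 1) := fun h => hσnot (mem_filter.2 ⟨h, hP⟩)
    exact sum_eq_zero fun x'' _ => by rw [sectorisedKernel_eq_zero_of_not_mem_bgmSectorSet β F' T hT hnot x'', norm_zero, mul_zero]

/-! ## §4 The composed weighted import: count × weighted transfer × weighted plain line -/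

omit [DecidableEq Λ] in
/-- **WEIGHTED ONE-ANCHOR SIZE FROM THE WEIGHTED PLAIN LINE** (any momentum-conserving `T`, any `J`, rate `j`, leg count `m + 1`): if the single multipliers `F_{J,ω}`
have rate-`j` weighted character sums `≤ T₁`, the one-anchor count of `bgmSectorSet (F_J) (m+1)` at leg `q` is `≤ N_c`, and every `klScaleWt_j`-weighted PLAIN pinned
sum at leg `q` is `≤ Sʷ`, then `klWtPinnedSumAt L M β μ K J j (m+1) T q (y, ℓ) ≤ N_c · ((T₁/(βL²))^m·(T₁/(βL²))·ε^{m+1}·Sʷ)`.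
[cite: BenfattoGiulianiMastropietro2006, §2.7 (2.71a), §2.8 (2.76)-(2.77)] -/
theorem klWtPinnedSumAt_le_count_mul_of_wplain {β : ℝ} (hβ : 0 < β) (μ : ℝ) (K : TrigPolyC4v) (J j m : ℕ) (T : HubbardGrassmann L M)
    (hT : ∀ (m' : ℕ) (X : Fin m' → HubbardFieldIdx L M), ∑ i, signedMomentum L (X i).2 (X i).1.1.2 ≠ 0 → kernel ℂ T m' X = 0)
    {T₁ : ℝ} (hT₁0 : 0 ≤ T₁)
    (hT₁ : ∀ ω : Fin (sectorCount J), ∑ z : TorusSite 1 (2 * M) × TorusSite 2 L,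
      (1 + klScale klE0 j * β / (2 * M) * |(((z.1 0).valMinAbs : ℤ) : ℝ)| + klScale klE0 j * |(((z.2 0).valMinAbs : ℤ) : ℝ)| +
          klScale klE0 j * |(((z.2 1).valMinAbs : ℤ) : ℝ)|) *
      ‖∑ q : TorusSite 1 (2 * M) × TorusSite 2 L, (torusChar q.1 z.1 * torusChar q.2 z.2) •
        klAnisoFamily L M β μ K klE0 J ω (⟨(q.1 0).val, ZMod.val_lt (q.1 0)⟩, q.2)‖ ≤ T₁)
    (q : Fin (m + 1)) (y : SpaceTimeIdx L M) (ℓ : SectorLeg (sectorCount J)) {Nc Sw : ℝ} (hSw : 0 ≤ Sw)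
    (hcount : ((((bgmSectorSet L M (klAnisoFamily L M β μ K klE0 J) (m + 1)).filter
        (fun σ : Fin (m + 1) → SectorLeg (sectorCount J) => σ q = ℓ)).card : ℕ) : ℝ) ≤ Nc)
    (hplain : ∀ (τ' : Fin (m + 1) → SectorLeg 1) (y' : SpaceTimeIdx L M),
      imagTimeWeight β M ^ m * ∑ x' ∈ univ.filter (fun x' : Fin (m + 1) → SpaceTimeIdx L M => x' q = y'),
        klScaleWt L M β j ((univ.image x').image (fun x : SpaceTimeIdx L M => (((((2 * (x.1 : ℕ) : ℕ)) : ZMod (2 * (2 * M)))), x.2))) *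
          ‖sectorisedKernel L M β (trivialMultiplier L M) T (m + 1) τ' x'‖ ≤ Sw) :
    klWtPinnedSumAt L M β μ K J j (m + 1) T q (y, ℓ) ≤
      Nc * ((T₁ / (β * (L : ℝ) ^ 2)) ^ m * (T₁ / (β * (L : ℝ) ^ 2)) * imagTimeWeight β M ^ (m + 1) * Sw) := by
  have hL0 : (0 : ℝ) < L := Nat.cast_pos.2 (Nat.pos_of_ne_zero (NeZero.ne L))
  have hc0 : 0 ≤ T₁ / (β * (L : ℝ) ^ 2) := by positivity
  have hε0 : 0 ≤ imagTimeWeight β M := imagTimeWeight_nonneg hβ.le M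
  have hwt : IsTreeWeight (klScaleWt L M β j) := isTreeWeight_klScaleWt L M hβ.le j
  set gpos : SpaceTimeIdx L M → ZMod (2 * (2 * M)) × TorusSite 2 L :=
    fun x => (((((2 * (x.1 : ℕ) : ℕ)) : ZMod (2 * (2 * M)))), x.2) with hgpos
  -- `hrowS`: sums over the second (coarse) position; `hcolS`: sums over the first (fine) position
  obtain ⟨hrowS, hcolS⟩ := transferSumsWt_klAniso_single_le hβ μ K J j hT₁
  have hB : 0 ≤ (T₁ / (β * (L : ℝ) ^ 2)) ^ m * (T₁ / (β * (L : ℝ) ^ 2)) * imagTimeWeight β M ^ (m + 1) * Sw := by positivity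
  refine klWtPinnedSumAt_le_count_mul_wline hβ μ K J j m T hT q y ℓ hB hcount fun σ _ => ?_
  exact wprescribedSum_klAniso_le_of_plain_treeWt hwt gpos hβ μ K J T hc0 hc0 hSw
    (fun ω'' σ' c x' => hcolS ω'' σ' c x') (fun ω'' σ' c x'' => hrowS ω'' σ' c x'') m σ q hplain y

end Summit.HubbardSuperconductivity.HubbardSuperconductivity.Theorems.EngineV8

end
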